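import Summits.QuantumFields.BalabanUV.T4Continuum.Support.ShellMeasureCommutatorLocGrad
import Summits.QuantumFields.BalabanUV.T4Continuum.Support.ShellMeasureCommutatorGradient
import Summits.QuantumFields.BalabanUV.T4Continuum.Support.ShellMeasureMultiGridNormsMax

/-!
# `T4Continuum.ShellMeasureCommutatorCovDatum` — row S65 f5 (junction J2, part b): the COVARIANT-DERIVATIVE DATUM of
# the finite-volume commutator functional as a continuous linear map, `C²`-regularity of the functional, and the
# `∇`-PART OF (98) AS `Prop4Hyp` AT ONE GRID from the source space `max{|·|, |∇·|}` (leaf-05's bound, packaged)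
# (cell `pub-balaban`, sub-cell `t4`, spine estimate NE7c (node U5b), crew lineage `b2b-balaban-t4-ne7c-formalise-leaf-02`
# gen 8, owner table `LEAVES-NE7c-P1.md` row S65; imports this lineage's f5a `ShellMeasureCommutatorLocGrad` and f2c
# `ShellMeasureMultiGridNormsMax`, and leaf-05-g7's S65 f3c `ShellMeasureCommutatorGradient` (p222569) ONLY; [folklore];
# 0 sorry)

HONEST FRAMING.  Finite four-torus programme, rung (B)+1 only — NOT infinite volume, NOT a mass gap, NOT the Clay
problem, NOT summit progress; (B), `BetaPertHyp`, (B^μ) are not consumed.  NE7c (`T4IndicatorShell.ShellWeightBound`)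
is NOT PRINTED and NOT PROVED; «NE7c ⇐ the named binders» (WALL `t4/b2b-balaban-t4-ne7c-p1/WALL-NE7c-P1.md` §2).
ELEMENTARY calculus on a normed `ℂ`-algebra ([folklore]); [Balaban1985Variational] (39)∕(91)–(98) are LOCATORS for the
shape only — the paper is under adjudication; nothing printed is asserted or cited as a fact; no `def … : Prop` is
minted (the `def`s are DATA: an index set, three continuous linear maps, the unit weight).  HONEST DEPENDENCY (cell):
continuum YM on T⁴ ⇐ BetaPertH ∧ nine spine estimates (0/9 proved); BetaPertH ⇐ (D1) ∧ (D4) ∧ CAP+tail; G-an2-4 gates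
asym, D1 and NE2/3/4.

THE POINT.  (98) reads `|(δ∕δA′)V|_{(−3)} ≤ C₄(max{|A′|_{(−1)}, |∇A′|_{(−2)}})²`; its `∇`-part (the first term of (39),
gain = (93) + [6] (1.52)) is KERNEL at one grid in leaf-05-g7's S65 f3 (`ShellMeasureCommutatorGradient.
norm_sum_dcub_bump_le`: `|Σ_p dcub(B)[ι_bX](p)| ≤ 176(d−1)·|w|·‖τ‖·a·G·‖X‖` for `|B| ≤ a`, `|∇^η_{U₀}B| ≤ G`), and f5a
identifies that variation with S62's `locGrad` of the finite-volume functional `cubT`.  To read it as END-II's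
`Prop4Hyp` one needs (i) the `∇` of (98) as a DATUM — a continuous linear map from the fields on the finite bond set
`Λ` to a finite family of values — and (ii) `C²`-regularity of `cubT` (the `DifferentiableOn` clause is about
`locGrad cubT`).  THIS FILE:
* §1 `covIdx Λ` (the finite set of triples `(y, κ, τ)` at which `D^η_{U₀,κ}(ext A)_τ(y)` can be non-zero), `extL`
  (evaluation of the extension as a CLM), `conjL` (conjugation by a unit as a CLM), **`covD Λ η U₀ : (↥Λ → 𝔸) →L[ℂ]
  (↥(covIdx Λ) → 𝔸)`** with `covD_apply` (= b08's `covDerivFwd` of the extended field), `covDerivFwd_ext_eq_zero` off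
  `covIdx`, and the two SUP FACTS `norm_ext_le` (`|ext A| ≤ ‖A‖`) ∕ `norm_covDerivFwd_ext_le` (`|∇(ext A)| ≤ ‖covD A‖`
  EVERYWHERE on the infinite lattice);
* §2 `contDiff_cubT` (`cubT` is `C^n` for every `n` — the f5a chain redone with `ContDiff`), hence
  `differentiable_locGrad_cubT`;
* §3 **`norm_locGrad_cubT_le_flat`** ∕ `…_covD`: `‖locGrad (cubT …) A b‖ ≤ 176(d−1)·‖w‖·‖τ‖·‖A‖·‖Dv A‖` for every
  bond `b` of `Λ` whose star lies in `Pl` and ANY `∇`-datum `Dv` dominating the covariant derivatives of the extended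
  field (`covD` is one) (f3c + f5a `norm_locGrad_cubT_le`), and **`prop4Hyp_locGrad_cubT_oneGrid`**: at ONE GRID
  (unit weights) the `∇`-part satisfies `Prop4Hyp (…) (176(d−1)·‖w‖·‖τ‖) a₃` FROM f2c's source space
  `WMax 1 1 Dv` (= `max{sup|A|, sup|Dv A|}`) to `WSup 1 3 (𝔸 →L[ℂ] ℂ)`, for EVERY radius `a₃` (the bound is
  globally quadratic — no smallness), whenever `Pl` contains the stars of all bonds of `Λ`.
NOT HERE: the MULTI-GRID version (needs leaf-05's localised f3d — NOTE l.15673 — then the weights enter exactly as in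
f2b: a later file), the identification with the actual action's `ord₃` (S65 f4), the HD-dressing (S66), [dict].
Typing + packaging only; no estimate of Bałaban's is discharged beyond what f3c proves at one grid.
-/

noncomputable section

open scoped BigOperators

namespace Summit.QuantumFields.BalabanUV.T4Continuum.ShellMeasureCommutatorCovDatum

open Literature.MathematicalPhysics.QuantumFieldTheory.Balaban1983to89
open B7Prop1Explicit (e U1)
open B7Eq78Linearization (conjR conjR_apply)
open B8Ineq132 (covDerivFwd)
open B8Eq146AExpansion (X1 X2 X3 X4 lin adR plaqCovDeriv)
open B8Eq151V2Divergence (brk)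
open B11Prop6Scheme (Prop4Hyp)
open Summit.QuantumFields.BalabanUV.T4Continuum.ShellMeasureCommutatorVariation (bump cub dcub plaqStar)
open Summit.QuantumFields.BalabanUV.T4Continuum.ShellMeasureCommutatorGradient (norm_sum_dcub_bump_le)
open Summit.QuantumFields.BalabanUV.T4Continuum.ShellMeasureCommutatorLocGrad
open Summit.QuantumFields.BalabanUV.T4Continuum.ShellMeasureLocalGradientTail (sgl locGrad locGrad_apply)
open Summit.QuantumFields.BalabanUV.T4Continuum.ShellMeasureMultiGridNorms
open Summit.QuantumFields.BalabanUV.T4Continuum.ShellMeasureMultiGridNormsMax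

export B7Prop1Explicit (Site)

variable {d : ℕ} {𝔸 : Type*} [NormedRing 𝔸] [NormedAlgebra ℂ 𝔸]

/-! ## §1 The covariant-derivative datum of the finite-volume field as a continuous linear map -/

variable (Λ : Finset (Site d × Fin d))

/-- Evaluation of the extension by zero at a bond, as a continuous linear map (a coordinate projection on `Λ`, zero
off `Λ`). [folklore] -/
def extL (x : Site d) (μ : Fin d) : (↥Λ → 𝔸) →L[ℂ] 𝔸 :=
  if h : (x, μ) ∈ Λ then ContinuousLinearMap.proj (R := ℂ) (φ := fun _ : ↥Λ => 𝔸) ⟨(x, μ), h⟩ else 0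

/-- `extL Λ x μ A = ext Λ A x μ`. [folklore] -/
theorem extL_apply (x : Site d) (μ : Fin d) (A : ↥Λ → 𝔸) : extL Λ x μ A = ext Λ A x μ := by
  by_cases h : (x, μ) ∈ Λ
  · rw [ext_apply_of_mem Λ A h]
    simp [extL, h]
  · rw [ext_apply_of_not_mem Λ A h]
    simp [extL, h]

omit [NormedAlgebra ℂ 𝔸] in
/-- `|ext A(x, μ)| ≤ ‖A‖` everywhere on the infinite lattice (the global sup bound f3c asks for). [folklore] -/
theorem norm_ext_le (A : ↥Λ → 𝔸) (x : Site d) (μ : Fin d) : ‖ext Λ A x μ‖ ≤ ‖A‖ := by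
  by_cases h : (x, μ) ∈ Λ
  · rw [ext_apply_of_mem Λ A h]
    exact norm_le_pi_norm A _
  · rw [ext_apply_of_not_mem Λ A h, norm_zero]
    exact norm_nonneg A

/-- Conjugation by a fixed unit as a continuous linear map. [folklore] -/
def conjL (u : 𝔸ˣ) : 𝔸 →L[ℂ] 𝔸 := ContinuousLinearMap.mulLeftRight ℂ 𝔸 (u : 𝔸) ((u⁻¹ : 𝔸ˣ) : 𝔸)

/-- `conjL u X = conjR u X`. [folklore] -/
theorem conjL_apply (u : 𝔸ˣ) (X : 𝔸) : conjL u X = conjR u X := by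
  rw [conjL, ContinuousLinearMap.mulLeftRight_apply, conjR_apply]

/-- THE INDEX SET OF THE `∇`-DATUM: the triples `(y, κ, τ)` for which the forward covariant derivative
`D^η_{U₀,κ}(ext A)_τ(y) = η⁻¹(R(U₀(y, y+e_κ))(ext A)(y+e_κ, τ) − (ext A)(y, τ))` can be non-zero, i.e. `(y, τ) ∈ Λ` or
`(y + e_κ, τ) ∈ Λ`. [folklore] -/
def covIdx : Finset (Site d × Fin d × Fin d) :=
  (Λ ×ˢ (Finset.univ : Finset (Fin d))).image (fun q => (q.1.1, q.2, q.1.2)) ∪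
    (Λ ×ˢ (Finset.univ : Finset (Fin d))).image (fun q => (q.1.1 - e q.2, q.2, q.1.2))

omit [NormedRing 𝔸] [NormedAlgebra ℂ 𝔸] in
/-- If `(y, τ) ∈ Λ` then `(y, κ, τ) ∈ covIdx Λ`. [folklore] -/
theorem mem_covIdx_of_mem {y : Site d} {κ τ : Fin d} (h : (y, τ) ∈ Λ) : (y, κ, τ) ∈ covIdx Λ := by
  refine Finset.mem_union_left _ (Finset.mem_image.2 ⟨((y, τ), κ), ?_, rfl⟩)
  simp [h]

omit [NormedRing 𝔸] [NormedAlgebra ℂ 𝔸] in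
/-- If `(y + e_κ, τ) ∈ Λ` then `(y, κ, τ) ∈ covIdx Λ`. [folklore] -/
theorem mem_covIdx_of_mem_add {y : Site d} {κ τ : Fin d} (h : (y + e κ, τ) ∈ Λ) : (y, κ, τ) ∈ covIdx Λ := by
  refine Finset.mem_union_right _ (Finset.mem_image.2 ⟨((y + e κ, τ), κ), ?_, ?_⟩)
  · simp [h]
  · simp

variable (η : ℝ) (U₀ : Site d → Fin d → 𝔸ˣ)

/-- One component of the `∇`-datum as a CLM: `A ↦ D^η_{U₀,κ}(ext A)_τ(y)`. [folklore] -/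
def covDComp (y : Site d) (κ τ : Fin d) : (↥Λ → 𝔸) →L[ℂ] 𝔸 :=
  ((η⁻¹ : ℝ) : ℂ) • ((conjL (U₀ y κ)).comp (extL Λ (y + e κ) τ) - extL Λ y τ)

/-- `covDComp … y κ τ A = covDerivFwd η U₀ κ (fun z => ext Λ A z τ) y`. [folklore] -/
theorem covDComp_apply (y : Site d) (κ τ : Fin d) (A : ↥Λ → 𝔸) :
    covDComp Λ η U₀ y κ τ A = covDerivFwd η U₀ κ (fun z => ext Λ A z τ) y := by
  simp only [covDComp, FunLike.coe_smul, FunLike.coe_sub, Pi.smul_apply, Pi.sub_apply,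
    ContinuousLinearMap.comp_apply, extL_apply, conjL_apply, covDerivFwd, Complex.coe_smul]

/-- **THE `∇`-DATUM** `covD Λ η U₀ : (↥Λ → 𝔸) →L[ℂ] (↥(covIdx Λ) → 𝔸)`, `A ↦ (D^η_{U₀,κ}(ext A)_τ(y))_{(y,κ,τ) ∈ covIdx Λ}`
— the bounded linear map (98)'s `|∇A′|_{(−2)}` is the weighted sup of (Bałaban: `∇^η_{U₀}`, background-dependent).
[folklore] -/
def covD : (↥Λ → 𝔸) →L[ℂ] (↥(covIdx Λ) → 𝔸) :=
  ContinuousLinearMap.pi fun i : ↥(covIdx Λ) => covDComp Λ η U₀ i.1.1 i.1.2.1 i.1.2.2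

/-- Unfolding. [folklore] -/
theorem covD_apply (A : ↥Λ → 𝔸) (i : ↥(covIdx Λ)) :
    covD Λ η U₀ A i = covDerivFwd η U₀ i.1.2.1 (fun z => ext Λ A z i.1.2.2) i.1.1 := by
  rw [covD, ContinuousLinearMap.pi_apply, covDComp_apply]

/-- Off `covIdx Λ` the covariant derivative of an extended field vanishes. [folklore] -/
theorem covDerivFwd_ext_eq_zero {y : Site d} {κ τ : Fin d} (h : (y, κ, τ) ∉ covIdx Λ) (A : ↥Λ → 𝔸) :
    covDerivFwd η U₀ κ (fun z => ext Λ A z τ) y = 0 := by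
  have h1 : (y + e κ, τ) ∉ Λ := fun hm => h (mem_covIdx_of_mem_add Λ hm)
  have h2 : (y, τ) ∉ Λ := fun hm => h (mem_covIdx_of_mem Λ hm)
  simp only [covDerivFwd, ext_apply_of_not_mem Λ A h1, ext_apply_of_not_mem Λ A h2, conjR_apply, mul_zero,
    zero_mul, sub_zero, smul_zero]

/-- `|∇(ext A)| ≤ ‖covD A‖` EVERYWHERE on the infinite lattice (the global sup bound f3c asks for). [folklore] -/
theorem norm_covDerivFwd_ext_le (A : ↥Λ → 𝔸) (y : Site d) (κ τ : Fin d) :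
    ‖covDerivFwd η U₀ κ (fun z => ext Λ A z τ) y‖ ≤ ‖covD Λ η U₀ A‖ := by
  by_cases h : (y, κ, τ) ∈ covIdx Λ
  · have h1 := norm_le_pi_norm (covD Λ η U₀ A) ⟨(y, κ, τ), h⟩
    rw [covD_apply] at h1
    exact h1
  · rw [covDerivFwd_ext_eq_zero Λ η U₀ h, norm_zero]
    exact norm_nonneg _

/-! ## §2 `C²`-regularity of the finite-volume functional -/

section Smooth

variable (Pl : Finset (Fin d × Fin d × Site d)) (w : ℂ) (τ : 𝔸 →L[ℂ] ℂ)

/-- `A ↦ ext Λ A x μ` is smooth (a CLM). [folklore] -/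
theorem contDiff_ext_apply {n : WithTop ℕ∞} (x : Site d) (μ : Fin d) :
    ContDiff ℂ n fun A : ↥Λ → 𝔸 => ext Λ A x μ := by
  have h : (fun A : ↥Λ → 𝔸 => ext Λ A x μ) = extL Λ x μ := by
    funext A
    exact (extL_apply Λ x μ A).symm
  rw [h]
  exact (extL (𝔸 := 𝔸) Λ x μ).contDiff

/-- Conjugation by a fixed unit preserves smoothness. [folklore] -/
theorem contDiff_conjR {n : WithTop ℕ∞} (u : 𝔸ˣ) {f : (↥Λ → 𝔸) → 𝔸} (hf : ContDiff ℂ n f) :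
    ContDiff ℂ n fun A => conjR u (f A) := by
  have h : (fun A => conjR u (f A)) = fun A => (u : 𝔸) * f A * ((u⁻¹ : 𝔸ˣ) : 𝔸) := by
    funext A
    exact conjR_apply u (f A)
  rw [h]
  exact (contDiff_const.mul hf).mul contDiff_const

/-- The commutator of smooth maps is smooth. [folklore] -/
theorem contDiff_adR {n : WithTop ℕ∞} {f g : (↥Λ → 𝔸) → 𝔸} (hf : ContDiff ℂ n f) (hg : ContDiff ℂ n g) :
    ContDiff ℂ n fun A => adR (f A) (g A) := by
  unfold adR
  exact (hf.mul hg).sub (hg.mul hf)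

/-- One cubic density of the extended field is smooth in the field. [folklore] -/
theorem contDiff_cub {n : WithTop ℕ∞} (μ ν : Fin d) (x : Site d) :
    ContDiff ℂ n fun A : ↥Λ → 𝔸 => cub w τ η U₀ (ext Λ A) μ ν x := by
  have h1 : ContDiff ℂ n fun A : ↥Λ → 𝔸 => X1 (ext Λ A) μ x := contDiff_ext_apply Λ x μ
  have h2 : ContDiff ℂ n fun A : ↥Λ → 𝔸 => X2 U₀ (ext Λ A) μ ν x :=
    contDiff_conjR Λ (U₀ x μ) (contDiff_ext_apply Λ (x + e μ) ν)
  have h3 : ContDiff ℂ n fun A : ↥Λ → 𝔸 => X3 U₀ (ext Λ A) μ ν x :=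
    contDiff_conjR Λ (U₀ x ν) (contDiff_ext_apply Λ (x + e ν) μ).neg
  have h4 : ContDiff ℂ n fun A : ↥Λ → 𝔸 => X4 (ext Λ A) ν x := (contDiff_ext_apply Λ x ν).neg
  have hplaq : ContDiff ℂ n fun A : ↥Λ → 𝔸 => plaqCovDeriv η U₀ (ext Λ A) μ ν x := by
    unfold plaqCovDeriv lin
    exact (((h1.add h2).add h3).add h4).const_smul _
  have hbrk : ContDiff ℂ n fun A : ↥Λ → 𝔸 => brk U₀ (ext Λ A) μ ν x := by
    unfold brk
    exact (((((contDiff_adR Λ h1 h2).add (contDiff_adR Λ h1 h3)).add (contDiff_adR Λ h1 h4)).add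
      (contDiff_adR Λ h2 h3)).add (contDiff_adR Λ h2 h4)).add (contDiff_adR Λ h3 h4)
  unfold cub
  exact contDiff_const.mul (τ.contDiff.comp (hplaq.mul hbrk))

/-- **`cubT` IS SMOOTH** (a continuous cubic polynomial in the bond variables). [folklore] -/
theorem contDiff_cubT {n : WithTop ℕ∞} : ContDiff ℂ n (cubT Λ Pl w τ η U₀) := by
  have h : cubT Λ Pl w τ η U₀ = fun A => ∑ p ∈ Pl, cub w τ η U₀ (ext Λ A) p.1 p.2.1 p.2.2 := rfl
  rw [h]
  exact ContDiff.sum fun p _ => contDiff_cub Λ η U₀ w τ p.1 p.2.1 p.2.2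

/-- Hence `locGrad (cubT …)` is differentiable everywhere (the `DifferentiableOn` clause of `Prop4Hyp`, flat form).
[folklore] -/
theorem differentiable_locGrad_cubT : Differentiable ℂ (locGrad (cubT Λ Pl w τ η U₀)) := by
  have h2 : ContDiff ℂ 2 (cubT Λ Pl w τ η U₀) := contDiff_cubT Λ η U₀ Pl w τ
  have hf : Differentiable ℂ (fderiv ℂ (cubT Λ Pl w τ η U₀)) :=
    (h2.fderiv_right (m := 1) le_rfl).differentiable one_ne_zero
  exact differentiable_pi.2 fun b => hf.clm_comp (differentiable_const (sgl b))

end Smooth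

/-! ## §3 The `∇`-part of (98) as `Prop4Hyp` at ONE GRID -/

section OneGrid

variable [NormOneClass 𝔸] (Pl : Finset (Fin d × Fin d × Site d)) (w : ℂ) {τ : 𝔸 →L[ℂ] ℂ}

/-- **THE FLAT BOUND**: for every bond `b` of `Λ` whose star lies in the (increasing) plaquette set `Pl`, and ANY
`∇`-datum `Dv` dominating the covariant derivatives of the extended field (`covD Λ η U₀` is one, by
`norm_covDerivFwd_ext_le`): `‖locGrad (cubT …) A b‖ ≤ 176(d−1)·‖w‖·‖τ‖·‖A‖·‖Dv A‖` — leaf-05's f3c bound with the two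
scales read as flat sup norms. [folklore] -/
theorem norm_locGrad_cubT_le_flat {η : ℝ} (hη : 0 < η) {U₀ : Site d → Fin d → 𝔸ˣ} (h₀ : ∀ y κ, U₀ y κ ∈ U1 𝔸)
    (htr : ∀ P Q : 𝔸, τ (P * Q) = τ (Q * P)) (hincr : ∀ p ∈ Pl, p.1 < p.2.1)
    {I : Type*} [Fintype I] (Dv : (↥Λ → 𝔸) →L[ℂ] (I → 𝔸))
    (hDv : ∀ (A : ↥Λ → 𝔸) (y : Site d) (κ τ' : Fin d), ‖covDerivFwd η U₀ κ (fun z => ext Λ A z τ') y‖ ≤ ‖Dv A‖)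
    (A : ↥Λ → 𝔸) (b : ↥Λ) (hst : plaqStar b.1.1 b.1.2 ⊆ Pl) :
    ‖locGrad (cubT Λ Pl w τ η U₀) A b‖ ≤ 176 * ((d : ℝ) - 1) * ‖w‖ * ‖τ‖ * ‖A‖ * ‖Dv A‖ := by
  have hd : 0 ≤ (d : ℝ) - 1 := by
    have : 1 ≤ d := Nat.succ_le_of_lt (Fin.pos b.1.2)
    have : (1 : ℝ) ≤ d := by exact_mod_cast this
    linarith
  refine ShellMeasureCommutatorLocGrad.norm_locGrad_cubT_le Λ Pl w τ η U₀ A b (by positivity) fun X => ?_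
  exact norm_sum_dcub_bump_le hη h₀ (norm_ext_le Λ A) (hDv A) w htr hst hincr X

/-- The canonical instance: `Dv = covD Λ η U₀`. [folklore] -/
theorem norm_locGrad_cubT_le_covD {η : ℝ} (hη : 0 < η) {U₀ : Site d → Fin d → 𝔸ˣ} (h₀ : ∀ y κ, U₀ y κ ∈ U1 𝔸)
    (htr : ∀ P Q : 𝔸, τ (P * Q) = τ (Q * P)) (hincr : ∀ p ∈ Pl, p.1 < p.2.1)
    (A : ↥Λ → 𝔸) (b : ↥Λ) (hst : plaqStar b.1.1 b.1.2 ⊆ Pl) :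
    ‖locGrad (cubT Λ Pl w τ η U₀) A b‖ ≤ 176 * ((d : ℝ) - 1) * ‖w‖ * ‖τ‖ * ‖A‖ * ‖covD Λ η U₀ A‖ :=
  norm_locGrad_cubT_le_flat Λ Pl w hη h₀ htr hincr (covD Λ η U₀) (norm_covDerivFwd_ext_le Λ η U₀) A b hst

/-- The unit weight (one grid: every bond at the same scale). [folklore] -/
def unitW (ι : Type*) : ι → ℝ := fun _ => 1

/-- The unit weight is positive. [folklore] -/
instance fact_unitW_pos (ι : Type*) : Fact (∀ b : ι, 0 < unitW ι b) := ⟨fun _ => one_pos⟩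

omit [NormedRing 𝔸] [NormedAlgebra ℂ 𝔸] [NormOneClass 𝔸] in
/-- `unitW ι b = 1`. [folklore] -/
@[simp] theorem unitW_apply (ι : Type*) (b : ι) : unitW ι b = 1 := rfl

/-- **THE `∇`-PART OF (98) AS `Prop4Hyp`, ONE GRID.**  With unit weights and ANY `∇`-datum `Dv : (↥Λ → 𝔸) →L[ℂ] (I → 𝔸)`
dominating the covariant derivatives of the extended field (e.g. `covD Λ η U₀`), from f2c's source space
`WMax 1 1 Dv` (norm `max{sup_b ‖A b‖, sup_i ‖Dv A i‖}`) to `WSup 1 3 (𝔸 →L[ℂ] ℂ)`, the bond-local gradient of the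
finite-volume commutator functional satisfies `Prop4Hyp (…) (176(d−1)·‖w‖·‖τ‖) a₃` for EVERY `a₃` (the bound is
globally quadratic), provided `Pl` is a finite set of increasing plaquettes containing the star of every bond of `Λ`,
`U₀` is `U1`-valued and `τ` is tracial.  [Balaban1985Variational] (98) TYPE for the `∇`-part at `j = 0` — nothing
printed is asserted; the multi-grid weights enter in a later file over leaf-05's localised bound. [folklore] -/
theorem prop4Hyp_locGrad_cubT_oneGrid {η : ℝ} (hη : 0 < η) {U₀ : Site d → Fin d → 𝔸ˣ} (h₀ : ∀ y κ, U₀ y κ ∈ U1 𝔸)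
    (htr : ∀ P Q : 𝔸, τ (P * Q) = τ (Q * P)) (hincr : ∀ p ∈ Pl, p.1 < p.2.1)
    (hst : ∀ b : ↥Λ, plaqStar b.1.1 b.1.2 ⊆ Pl) {I : Type*} [Fintype I] (Dv : (↥Λ → 𝔸) →L[ℂ] (I → 𝔸))
    (hDv : ∀ (A : ↥Λ → 𝔸) (y : Site d) (κ τ' : Fin d), ‖covDerivFwd η U₀ κ (fun z => ext Λ A z τ') y‖ ≤ ‖Dv A‖)
    (a₃ : ℝ) :
    Prop4Hyp (fun Y : WMax (unitW ↥Λ) (unitW I) Dv =>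
        ((WSup.toPiL (unitW ↥Λ) 3).symm
          (locGrad (cubT Λ Pl w τ η U₀) (WMax.toPiL (unitW ↥Λ) (unitW I) Dv Y)) : WSup (unitW ↥Λ) 3 (𝔸 →L[ℂ] ℂ)))
      (176 * ((d : ℝ) - 1) * ‖w‖ * ‖τ‖) a₃ where
  quad Y _ := by
    -- the two sizes of the flat field are below the max norm
    have hA1 : ‖(WMax.toPiL (unitW ↥Λ) (unitW I) Dv Y : ↥Λ → 𝔸)‖ ≤ ‖Y‖ := by
      refine (pi_norm_le_iff_of_nonneg (norm_nonneg Y)).2 fun b => ?_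
      have h := WSup.norm_apply_le (unitW ↥Λ) 1 (show WSup (unitW ↥Λ) 1 𝔸 from Y) b
      rw [unitW_apply, one_pow, one_mul] at h
      exact h.trans (WMax.norm_wsup_le _ _ _ Y)
    have hA2 : ‖Dv (WMax.toPiL (unitW ↥Λ) (unitW I) Dv Y)‖ ≤ ‖Y‖ := by
      refine (pi_norm_le_iff_of_nonneg (norm_nonneg Y)).2 fun i => ?_
      have h := WSup.norm_apply_le (unitW I) 2 (show WSup (unitW I) 2 𝔸 from Dv Y) i
      rw [unitW_apply, one_pow, one_mul] at h
      exact h.trans (WMax.norm_deriv_le _ _ _ Y)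
    by_cases hΛ : Nonempty ↥Λ
    · obtain ⟨b₀⟩ := hΛ
      have hd : 0 ≤ (d : ℝ) - 1 := by
        have : 1 ≤ d := Nat.succ_le_of_lt (Fin.pos b₀.1.2)
        have : (1 : ℝ) ≤ d := by exact_mod_cast this
        linarith
      have hC : 0 ≤ 176 * ((d : ℝ) - 1) * ‖w‖ * ‖τ‖ * ‖Y‖ ^ 2 := by positivity
      refine (WSup.norm_le_iff (unitW ↥Λ) 3 hC).2 fun b => ?_
      rw [unitW_apply, one_pow, one_mul]
      calc ‖locGrad (cubT Λ Pl w τ η U₀) (WMax.toPiL (unitW ↥Λ) (unitW I) Dv Y) b‖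
          ≤ 176 * ((d : ℝ) - 1) * ‖w‖ * ‖τ‖ * ‖(WMax.toPiL (unitW ↥Λ) (unitW I) Dv Y : ↥Λ → 𝔸)‖ *
              ‖Dv (WMax.toPiL (unitW ↥Λ) (unitW I) Dv Y)‖ :=
            norm_locGrad_cubT_le_flat Λ Pl w hη h₀ htr hincr Dv hDv _ b (hst b)
        _ ≤ 176 * ((d : ℝ) - 1) * ‖w‖ * ‖τ‖ * ‖Y‖ * ‖Y‖ := by
            have h0 : 0 ≤ 176 * ((d : ℝ) - 1) * ‖w‖ * ‖τ‖ := by positivity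
            have hm := mul_le_mul hA1 hA2 (norm_nonneg _) (norm_nonneg _)
            calc _ = 176 * ((d : ℝ) - 1) * ‖w‖ * ‖τ‖ * (‖(WMax.toPiL (unitW ↥Λ) (unitW I) Dv Y : ↥Λ → 𝔸)‖ *
                  ‖Dv (WMax.toPiL (unitW ↥Λ) (unitW I) Dv Y)‖) := by ring
              _ ≤ 176 * ((d : ℝ) - 1) * ‖w‖ * ‖τ‖ * (‖Y‖ * ‖Y‖) := mul_le_mul_of_nonneg_left hm h0
              _ = _ := by ring
        _ = 176 * ((d : ℝ) - 1) * ‖w‖ * ‖τ‖ * ‖Y‖ ^ 2 := by ring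
    · -- no bonds: `Y = 0`, both sides vanish
      have hY0 : Y = 0 := funext fun b => (hΛ ⟨b⟩).elim
      have hW0 : ‖((WSup.toPiL (unitW ↥Λ) 3).symm
          (locGrad (cubT Λ Pl w τ η U₀) (WMax.toPiL (unitW ↥Λ) (unitW I) Dv Y)) : WSup (unitW ↥Λ) 3 (𝔸 →L[ℂ] ℂ))‖
            ≤ 0 :=
        (WSup.norm_le_iff (unitW ↥Λ) 3 le_rfl).2 fun b => (hΛ ⟨b⟩).elim
      rw [hY0, norm_zero]
      rw [hY0] at hW0
      simpa using hW0
  differentiableOn := by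
    refine Differentiable.differentiableOn ?_
    exact ((WSup.toPiL (unitW ↥Λ) 3).symm.differentiable.comp
      (differentiable_locGrad_cubT Λ η U₀ Pl w τ)).comp (WMax.toPiL (unitW ↥Λ) (unitW I) Dv).differentiable

end OneGrid

end Summit.QuantumFields.BalabanUV.T4Continuum.ShellMeasureCommutatorCovDatum

end
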